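import Summits.AtomisticToContinuum.FouriersLaw.Theorems.CageBudgetFeketeUnboundedHeatVarianceSpectralHeatVarianceUnbounded
import HarnessLib

/-!
# Stub `stub_spectralIncrements` (I) of line `KaramataCollapse`
(crux `CoercivePulse.LinearSpread`, item stmt-AtomisticToContinuum-15382; `--supports` file, closes nothing)

WHAT. The registered stub I of the crux skeleton, a statement of pure real analysis: for a finite measure `ρ` on
`ℝ` and the spectral heat variance `V(τ) = 2∫_{(0,τ]} (τ − s)(∫ cos(ωs) dρ(ω)) ds`, the two-sided increment bound
`|√V(t) − √V(s)| ≤ √V(t − s)` for `0 ≤ s ≤ t`. This is the statement that `√V` is the norm of the displacement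
of an additive process with stationary increments, in spectral form: `√V(τ) = ‖ω ↦ τ·sinc(ωτ/2)‖_{L²(ρ)}` with
`τ·sinc(ωτ/2) = 2 sin(ωτ/2)/ω` for `ω ≠ 0`.

HOW. By the landed Fubini/Fejér form (`UnboundedHeatVariance.Birth.heatVariance_eq_integral_hvKernel`, same
import), `V(τ) = ∫ τ² sinc²(ωτ/2) dρ(ω)` for `τ ≥ 0`, whence `eLpNorm (ω ↦ τ·sinc(ωτ/2)) 2 ρ = ENNReal.ofReal √V(τ)`
(`MemLp.eLpNorm_eq_integral_rpow_norm`; the function is continuous and bounded by `|τ|`, so in `L²` of the finite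
`ρ`). Pointwise, `|sin(x + y)| ≤ |sin x| + |sin y|` gives `|g_{a+b}(ω)| ≤ |g_a(ω)| + |g_b(ω)|` for
`g_τ(ω) = τ·sinc(ωτ/2)` (at `ω = 0` it reads `|a + b| ≤ |a| + |b|`), and `g_{−b} = −g_b`; Minkowski in `L²(ρ)`
(`eLpNorm_add_le`) then yields `√V(t) ≤ √V(s) + √V(t − s)` and `√V(s) ≤ √V(t) + √V(t − s)`.
Mathlib only, plus the landed kernel lemmas. [folklore]
-/

noncomputable section

namespace Summit.AtomisticToContinuum.FouriersLaw.Theorems.LinearSpread.KaramataCollapse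

open MeasureTheory Set
open scoped ENNReal
open Summit.AtomisticToContinuum.FouriersLaw.Theorems.UnboundedHeatVariance.Birth

/-! ### Pointwise triangle inequalities for `g_τ(ω) = τ·sinc(ωτ/2)` -/

/-- For `ω ≠ 0`, `τ·sinc(ωτ/2) = 2 sin(ωτ/2)/ω`. [folklore] -/
theorem mul_sinc_eq_of_ne_zero {w : ℝ} (hw : w ≠ 0) (τ : ℝ) :
    τ * Real.sinc (w * τ / 2) = 2 * Real.sin (w * τ / 2) / w := by
  by_cases hτ : τ = 0
  · subst hτ
    simp
  · rw [Real.sinc_of_ne_zero (div_ne_zero (mul_ne_zero hw hτ) two_ne_zero)]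
    field_simp

/-- Pointwise subadditivity of `τ ↦ |τ·sinc(ωτ/2)|`: `|g_{a+b}(ω)| ≤ |g_a(ω)| + |g_b(ω)|` (for `ω ≠ 0` this is
`|sin(x + y)| ≤ |sin x| + |sin y|`, for `ω = 0` it is `|a + b| ≤ |a| + |b|`). [folklore] -/
theorem abs_mul_sinc_add_le (w a b : ℝ) :
    |(a + b) * Real.sinc (w * (a + b) / 2)| ≤
      |a * Real.sinc (w * a / 2)| + |b * Real.sinc (w * b / 2)| := by
  by_cases hw : w = 0
  · subst hw
    simp only [zero_mul, zero_div, Real.sinc_zero, mul_one]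
    exact abs_add_le a b
  · -- `|sin(x + y)| ≤ |sin x| + |sin y|` (addition formula, `|cos| ≤ 1`)
    have hsin : |Real.sin (w * a / 2 + w * b / 2)| ≤ |Real.sin (w * a / 2)| + |Real.sin (w * b / 2)| := by
      rw [Real.sin_add]
      refine (abs_add_le _ _).trans (add_le_add ?_ ?_)
      · rw [abs_mul]
        exact mul_le_of_le_one_right (abs_nonneg _) (Real.abs_cos_le_one _)
      · rw [abs_mul]
        exact mul_le_of_le_one_left (abs_nonneg _) (Real.abs_cos_le_one _)
    rw [mul_sinc_eq_of_ne_zero hw, mul_sinc_eq_of_ne_zero hw, mul_sinc_eq_of_ne_zero hw, abs_div,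
      abs_div, abs_div, abs_mul, abs_mul, abs_mul, ← add_div, ← mul_add]
    have hw' : 0 < |w| := abs_pos.2 hw
    gcongr
    rwa [show w * (a + b) / 2 = w * a / 2 + w * b / 2 by ring]

/-- First triangle inequality: `|g_t(ω)| ≤ |g_s(ω)| + |g_{t−s}(ω)|`. [folklore] -/
theorem abs_mul_sinc_le_add (w s t : ℝ) :
    |t * Real.sinc (w * t / 2)| ≤
      |s * Real.sinc (w * s / 2)| + |(t - s) * Real.sinc (w * (t - s) / 2)| := by
  have h := abs_mul_sinc_add_le w s (t - s)
  rwa [show s + (t - s) = t by ring] at h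

/-- Second triangle inequality: `|g_s(ω)| ≤ |g_t(ω)| + |g_{t−s}(ω)|` (`g_{s−t} = −g_{t−s}`). [folklore] -/
theorem abs_mul_sinc_le_add' (w s t : ℝ) :
    |s * Real.sinc (w * s / 2)| ≤
      |t * Real.sinc (w * t / 2)| + |(t - s) * Real.sinc (w * (t - s) / 2)| := by
  have h := abs_mul_sinc_add_le w t (s - t)
  rw [show t + (s - t) = s by ring] at h
  have h2 : (s - t) * Real.sinc (w * (s - t) / 2) = -((t - s) * Real.sinc (w * (t - s) / 2)) := by
    rw [show s - t = -(t - s) by ring, show w * -(t - s) / 2 = -(w * (t - s) / 2) by ring,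
      Real.sinc_neg, neg_mul]
  rwa [h2, abs_neg] at h

/-! ### `√V(τ)` is an `L²(ρ)` norm -/

/-- `ω ↦ τ·sinc(ωτ/2)` lies in `L²(ρ)` for a finite measure `ρ` (continuous, bounded by `|τ|`). [folklore] -/
theorem memLp_mul_sinc (ρ : Measure ℝ) [IsFiniteMeasure ρ] (τ : ℝ) :
    MemLp (fun w : ℝ => τ * Real.sinc (w * τ / 2)) 2 ρ :=
  MemLp.of_bound (by fun_prop : Continuous fun w : ℝ => τ * Real.sinc (w * τ / 2)).aestronglyMeasurable
    |τ| (ae_of_all _ fun w => by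
      rw [Real.norm_eq_abs, abs_mul]
      exact mul_le_of_le_one_right (abs_nonneg τ) (Real.abs_sinc_le_one _))

/-- The `L²(ρ)` norm of `ω ↦ τ·sinc(ωτ/2)` is `√(∫ τ² sinc²(ωτ/2) dρ(ω))`. [folklore] -/
theorem eLpNorm_mul_sinc (ρ : Measure ℝ) [IsFiniteMeasure ρ] (τ : ℝ) :
    eLpNorm (fun w : ℝ => τ * Real.sinc (w * τ / 2)) 2 ρ =
      ENNReal.ofReal (Real.sqrt (∫ w, τ ^ 2 * Real.sinc (w * τ / 2) ^ 2 ∂ρ)) := by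
  have h2 : (2 : ℝ≥0∞) ≠ 0 := two_ne_zero
  rw [(memLp_mul_sinc ρ τ).eLpNorm_eq_integral_rpow_norm h2 ENNReal.ofNat_ne_top, ENNReal.toReal_ofNat,
    Real.sqrt_eq_rpow, one_div]
  have hint : ∫ w, ‖τ * Real.sinc (w * τ / 2)‖ ^ (2 : ℝ) ∂ρ = ∫ w, τ ^ 2 * Real.sinc (w * τ / 2) ^ 2 ∂ρ :=
    integral_congr_ae (ae_of_all _ fun w => by
      simp only [Real.rpow_two, Real.norm_eq_abs, sq_abs, mul_pow])
  rw [hint]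

/-- **Minkowski step.** For a finite measure `ρ`, if `|g_a| ≤ |g_b| + |g_c|` pointwise then
`‖g_a‖_{L²(ρ)} ≤ ‖g_b‖_{L²(ρ)} + ‖g_c‖_{L²(ρ)}` in the form `√∫g_a² ≤ √∫g_b² + √∫g_c²`. [folklore] -/
theorem sqrt_integral_le_of_pointwise (ρ : Measure ℝ) [IsFiniteMeasure ρ] {a b c : ℝ}
    (hle : ∀ w : ℝ, |a * Real.sinc (w * a / 2)| ≤ |b * Real.sinc (w * b / 2)| + |c * Real.sinc (w * c / 2)|) :
    Real.sqrt (∫ w, a ^ 2 * Real.sinc (w * a / 2) ^ 2 ∂ρ) ≤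
      Real.sqrt (∫ w, b ^ 2 * Real.sinc (w * b / 2) ^ 2 ∂ρ) +
        Real.sqrt (∫ w, c ^ 2 * Real.sinc (w * c / 2) ^ 2 ∂ρ) := by
  have hmeas : ∀ τ : ℝ, AEStronglyMeasurable (fun w : ℝ => ‖τ * Real.sinc (w * τ / 2)‖) ρ := fun τ =>
    (memLp_mul_sinc ρ τ).aestronglyMeasurable.norm
  have h1 : eLpNorm (fun w : ℝ => a * Real.sinc (w * a / 2)) 2 ρ ≤
      eLpNorm (fun w : ℝ => b * Real.sinc (w * b / 2)) 2 ρ +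
        eLpNorm (fun w : ℝ => c * Real.sinc (w * c / 2)) 2 ρ :=
    calc eLpNorm (fun w : ℝ => a * Real.sinc (w * a / 2)) 2 ρ
        ≤ eLpNorm ((fun w : ℝ => ‖b * Real.sinc (w * b / 2)‖) + fun w : ℝ => ‖c * Real.sinc (w * c / 2)‖)
            2 ρ :=
          eLpNorm_mono_real fun w => by
            simpa only [Real.norm_eq_abs, Pi.add_apply] using hle w
      _ ≤ eLpNorm (fun w : ℝ => ‖b * Real.sinc (w * b / 2)‖) 2 ρ +
            eLpNorm (fun w : ℝ => ‖c * Real.sinc (w * c / 2)‖) 2 ρ :=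
          eLpNorm_add_le (hmeas b) (hmeas c) one_le_two
      _ = eLpNorm (fun w : ℝ => b * Real.sinc (w * b / 2)) 2 ρ +
            eLpNorm (fun w : ℝ => c * Real.sinc (w * c / 2)) 2 ρ := by
          rw [eLpNorm_norm, eLpNorm_norm]
  rw [eLpNorm_mul_sinc ρ, eLpNorm_mul_sinc ρ, eLpNorm_mul_sinc ρ,
    ← ENNReal.ofReal_add (Real.sqrt_nonneg _) (Real.sqrt_nonneg _),
    ENNReal.ofReal_le_ofReal_iff (add_nonneg (Real.sqrt_nonneg _) (Real.sqrt_nonneg _))] at h1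
  exact h1

/-! ### The stub -/

/-- **Stub I — `stub_spectralIncrements`.** For a finite measure `ρ` on `ℝ` and the spectral heat variance
`V(τ) = 2∫_{(0,τ]} (τ − s)(∫ cos(ωs) dρ(ω)) ds`, the increments of `√V` obey `|√V(t) − √V(s)| ≤ √V(t − s)` for
`0 ≤ s ≤ t`: `√V(τ)` is the `L²(ρ)` norm of `ω ↦ τ·sinc(ωτ/2) = 2 sin(ωτ/2)/ω` (landed Fubini/Fejér form of `V`),
the maps `τ ↦ |τ·sinc(ωτ/2)|` are subadditive and even in `τ` (`|sin(x ± y)| ≤ |sin x| + |sin y|`), and Minkowski's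
inequality in `L²(ρ)` concludes. [folklore; spectral form of the stationary-increments norm] -/
theorem stub_spectralIncrements :
    ∀ ρ : MeasureTheory.Measure ℝ, MeasureTheory.IsFiniteMeasure ρ → ∀ V : ℝ → ℝ,
      V = (fun τ : ℝ => 2 * ∫ s in Set.Ioc (0:ℝ) τ, (τ - s) * ∫ w : ℝ, Real.cos (w * s) ∂ρ) →
      ∀ s t : ℝ, 0 ≤ s → s ≤ t → |Real.sqrt (V t) - Real.sqrt (V s)| ≤ Real.sqrt (V (t - s)) := by
  intro ρ hρ V hV s t hs hst
  have ht : 0 ≤ t := hs.trans hst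
  have hts : 0 ≤ t - s := sub_nonneg.2 hst
  -- the Fubini/Fejér form of `V` on `τ ≥ 0`
  have hVeq : ∀ τ : ℝ, 0 ≤ τ → V τ = ∫ w, τ ^ 2 * Real.sinc (w * τ / 2) ^ 2 ∂ρ := by
    intro τ hτ
    rw [hV]
    exact heatVariance_eq_integral_hvKernel ρ hτ
  have h1 : Real.sqrt (V t) ≤ Real.sqrt (V s) + Real.sqrt (V (t - s)) := by
    rw [hVeq t ht, hVeq s hs, hVeq (t - s) hts]
    exact sqrt_integral_le_of_pointwise ρ fun w => abs_mul_sinc_le_add w s t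
  have h2 : Real.sqrt (V s) ≤ Real.sqrt (V t) + Real.sqrt (V (t - s)) := by
    rw [hVeq t ht, hVeq s hs, hVeq (t - s) hts]
    exact sqrt_integral_le_of_pointwise ρ fun w => abs_mul_sinc_le_add' w s t
  rw [abs_sub_le_iff]
  constructor <;> linarith

end Summit.AtomisticToContinuum.FouriersLaw.Theorems.LinearSpread.KaramataCollapse

end
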